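import Literature.NumberTheory.Automorphic.Liu2021.Thm418CyclotomicUnitsLocalNorms
import Literature.NumberTheory.Automorphic.Liu2021.LemD1AsPrintedIndexedNonVacuityNonsplitPlace
import Literature.NumberTheory.Automorphic.AdelicAdditiveCharacterGaloisTwist
import Literature.NumberTheory.Automorphic.AdeleAddCharLocalNontrivial
import Mathlib.RingTheory.Ideal.Int
import HarnessLib

/-!
# [Liu2021, Thm 4.18 (3), proof l. 2272–2278] — (NT) at the places not above `2`, in the currency of the
# Galois twist of the local additive character: the unit `κ` with `σ ∘ ψ_v = ψ_v(κ ·)` is a norm from `E_v = E ⊗_F F_v`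

Topic `NumberTheory/Automorphic/Liu2021`; namespace `Literature.NumberTheory.Automorphic.Liu2021`.  THEOREMS only
(no definition, no named fact, no `sorry`).  ADAPTER from `Thm418CyclotomicUnitsLocalNorms` (the Hilbert-symbol /
norm-subgroup form of (NT) at `𝔭 ∤ 2`, hypothesis «`t ≡ χ̄_p(σ) (mod 𝔭)`») to the currency in which the III-11 road of cell
`hodgecm-mathlib` consumes it (A-p19 06:50:51Z, binder `CyclotomicUnitIsLocalNorm`; B-p13 p610584
`AdelicAdditiveCharacterGaloisTwist`; B-p08's `LocalMp.galTwist`): the unit `κ ∈ F_v` for which `σ(ψ_v(r)) = ψ_v(κ r)` for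
all `r` (`ψ_v = adeleAddCharAt F v` the local component of Tate's character) — necessarily `κ = χ_{cyc,p}(σ)` read in
`F_v` — is a NORM from the place model `E_v = E ⊗_F F_v = ∏_{w ∣ v} E_w` (`UnitaryGroup.LocalRing`, with its conjugation
`conjLocal`), for `E/F = L/L⁺` CM, `μ` conjugate symplectic and `σ ∈ Aut(ℂ/M_μ)`.
HC_CM is proved only modulo the 7 printed citations until rung 0 closes.

WHAT IS PROVED (`L` CM, `L⁺` its maximal real subfield, `𝔭 ∤ 2` a finite place of `L⁺`).
* `eq_of_forall_adeleAddCharAt_mul_eq` — non-degeneracy: `ψ_v(a r) = ψ_v(b r)` for all `r` forces `a = b`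
  (`exists_adeleAddCharAt_ne_one`, Tate's Lemma 2.2.3).
* `valued_algebraMap_cyclotomicCharacter_sub_val_lt_one` — **`χ_{cyc,p}(σ) ≡ χ̄_p(σ) (mod 𝔭)`**: the `p`-adic cyclotomic
  character of `σ`, read in `L⁺_𝔭` through the canonical `ℚ_p`-algebra structure (`LocalField.adicCompletionPadicAlgebra`),
  is congruent modulo `𝔭` to its mod-`p` reduction (Mathlib `cyclotomicCharacter.toZModPow`, `modularCyclotomicCharacter.unique`).
* `exists_rat_prime_natCast_mem` — the rational prime below `𝔭`.
* **`exists_mul_conjLocal_eq_of_adeleAddCharAt_galoisTwist`** — (NT) at `𝔭 ∤ 2` in the road's currency: for `ψ = μ`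
  conjugate symplectic, `σ : ℂ ≃+* ℂ` fixing `fieldOfValues L μ` pointwise, `κ ∈ L⁺_𝔭` with `σ(ψ_𝔭(r)) = ψ_𝔭(κ r)` for all
  `r`: `∃ x : (LocalRing L 𝔭)ˣ, x · conjLocal x = κ` (`Thm418CyclotomicUnitsLocalNorms` +
  `LemD1IndexedNonVacuityNonsplitPlace.isNorm_iff_mem_quadraticNormSubgroup`).
The dyadic places need the projection formula of local class field theory and are not treated here.

## References
* [Liu2021] Y. Liu, *Fourier–Jacobi cycles and arithmetic relative trace formula*, Camb. J. Math. 9 (2021), proof of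
  Thm. 4.18 (3), TeX l. 2272–2278.
* [CasselsFrohlichANT1967] J. W. S. Cassels, A. Fröhlich (eds.), *Algebraic Number Theory* (1967), Ch. XV (Tate) §2.2.
* [NeukirchSchmidtWingberg2008] J. Neukirch, A. Schmidt, K. Wingberg, *Cohomology of Number Fields* (2008), (7.3.6)–(7.3.7).
-/

set_option autoImplicit false

noncomputable section

open scoped NumberField Valued
open NumberField IsDedekindDomain IsDedekindDomain.HeightOneSpectrum

namespace Literature.NumberTheory.Automorphic.Liu2021

open Literature.NumberTheory.QuadraticForms Literature.NumberTheory.GaloisRepresentations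
open Literature.NumberTheory.Automorphic

/-! ## §1 Local lemmas -/

section Local

variable {K : Type} [Field K] [NumberField K] (v : HeightOneSpectrum (𝓞 K))

/-- **Non-degeneracy of `ψ_v`**: if `ψ_v(a r) = ψ_v(b r)` for every `r ∈ K_v` then `a = b` — otherwise `ψ_v` would be
trivial on `(a − b) K_v = K_v`, contradicting `exists_adeleAddCharAt_ne_one` (the conductor of `ψ_v` is `𝔡_v⁻¹`).
[cite: CasselsFrohlichANT1967, Ch. XV (Tate), Lemma 2.2.3] -/
theorem eq_of_forall_adeleAddCharAt_mul_eq {a b : v.adicCompletion K}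
    (h : ∀ r : v.adicCompletion K, adeleAddCharAt K v (a * r) = adeleAddCharAt K v (b * r)) : a = b := by
  by_contra hab
  obtain ⟨u, hu⟩ := exists_adeleAddCharAt_ne_one K v
  have hab' : a - b ≠ 0 := sub_ne_zero.mpr hab
  apply hu
  have h1 := h (u / (a - b))
  have hsplit : a * (u / (a - b)) = b * (u / (a - b)) + u := by
    field_simp
    ring
  rw [hsplit, AddChar.map_add_eq_mul] at h1
  -- `ψ(b r) * ψ u = ψ(b r)` in the group `Circle`
  exact mul_eq_left.mp h1

omit [NumberField K] in
/-- The rational prime below a finite place: some prime number `ℓ` with `ℓ ∈ 𝔭_v` (Mathlib `Nat.absNorm_under_prime`,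
`Int.absNorm_under_mem`). [folklore] -/
private theorem exists_rat_prime_natCast_mem : ∃ ℓ : ℕ, ℓ.Prime ∧ ((ℓ : ℕ) : 𝓞 K) ∈ v.asIdeal := by
  haveI : v.asIdeal.IsPrime := v.isPrime
  haveI : NeZero v.asIdeal := ⟨by rw [Ideal.zero_eq_bot]; exact v.ne_bot⟩
  refine ⟨_, Nat.absNorm_under_prime v.asIdeal, ?_⟩
  have := Int.absNorm_under_mem v.asIdeal
  exact_mod_cast this

omit [NumberField K] in
/-- A natural number prime to the rational prime `p ∈ 𝔭_v` is not in `𝔭_v` (Bézout). [folklore] -/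
private theorem natCast_not_mem_of_coprime {p r : ℕ} (hp : ((p : ℕ) : 𝓞 K) ∈ v.asIdeal) (hr : Nat.Coprime r p) :
    ((r : ℕ) : 𝓞 K) ∉ v.asIdeal := by
  intro hrv
  obtain ⟨a, b, hab⟩ := (Nat.isCoprime_iff_coprime.mpr hr : IsCoprime (r : ℤ) (p : ℤ))
  have h1 : (1 : 𝓞 K) ∈ v.asIdeal := by
    have hab' := congrArg (Int.cast : ℤ → 𝓞 K) hab
    push_cast at hab'
    rw [← hab']
    exact v.asIdeal.add_mem (v.asIdeal.mul_mem_left _ hrv) (v.asIdeal.mul_mem_left _ hp)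
  exact v.isPrime.ne_top ((Ideal.eq_top_iff_one _).mpr h1)

/-- From `v(t − r) < 1` with `r ∈ ℕ` a `v`-adic unit: `v(t) = 1`. [folklore] -/
private theorem valued_eq_one_of_valued_sub_natCast_lt_one {r : ℕ} (hr : ((r : ℕ) : 𝓞 K) ∉ v.asIdeal)
    {t : v.adicCompletion K} (ht : Valued.v (t - (r : v.adicCompletion K)) < 1) : Valued.v t = 1 := by
  have hrv : Valued.v ((r : ℕ) : v.adicCompletion K) = 1 := by
    have := valued_algebraMap_eq_one K v hr
    simpa only [map_natCast] using this
  have : t = (t - (r : v.adicCompletion K)) + (r : v.adicCompletion K) := by ring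
  rw [this, Valuation.map_add_eq_of_lt_right _ (by rwa [hrv]), hrv]

/-- For a root of unity `t^p = 1`, the power `t^a` only depends on `a mod p`. [folklore] -/
private theorem pow_eq_pow_mod_of_pow_eq_one {M : Type*} [Monoid M] {t : M} {p : ℕ} (ht : t ^ p = 1) (a : ℕ) :
    t ^ a = t ^ (a % p) := by
  conv_lhs => rw [← Nat.mod_add_div a p, pow_add, pow_mul, ht, one_pow, mul_one]

/-- **`χ_{cyc,p}(σ) ≡ χ̄_p(σ) (mod 𝔭)`** in `K_v`, `v ∣ p`: the `p`-adic cyclotomic character of a ring automorphism `σ` of `ℂ`,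
read in `K_v` through the canonical `ℚ_p`-algebra structure, is within `𝔭`-adic distance `< 1` of (the representative in
`{0,…,p−1}` of) its mod-`p` reduction `χ̄_p(σ)` (Mathlib `cyclotomicCharacter.toZModPow` at level `1` and
`modularCyclotomicCharacter.unique`; `ℤ_p → 𝒪_v` and `|p|_v < 1`). [cite: NeukirchSchmidtWingberg2008, (7.3.6)–(7.3.7)] -/
theorem valued_algebraMap_cyclotomicCharacter_sub_val_lt_one {p : ℕ} [Fact p.Prime]
    (hp : ((p : ℕ) : 𝓞 K) ∈ v.asIdeal) (hcp : Nat.card (rootsOfUnity p ℂ) = p) (σ : ℂ ≃+* ℂ) :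
    letI := LocalField.adicCompletionPadicAlgebra v p hp
    Valued.v (algebraMap ℚ_[p] (v.adicCompletion K) (((cyclotomicCharacter ℂ p σ : ℤ_[p]ˣ) : ℤ_[p]) : ℚ_[p]) -
      (((modularCyclotomicCharacter ℂ hcp σ : (ZMod p)ˣ) : ZMod p).val : v.adicCompletion K)) < 1 := by
  letI := LocalField.adicCompletionPadicAlgebra v p hp
  classical
  have hpr : p.Prime := Fact.out
  haveI : NeZero p := ⟨hpr.ne_zero⟩
  set x : ℤ_[p] := ((cyclotomicCharacter ℂ p σ : ℤ_[p]ˣ) : ℤ_[p]) with hx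
  set a : ℕ := (x.toZModPow 1).val with ha
  -- `σ t = t ^ a` on the `p`-th roots of unity
  have hspec : ∀ t : ℂ, t ^ p = 1 → σ t = t ^ a := by
    intro t ht
    have := cyclotomicCharacter.spec p (n := 1) σ t (by rw [pow_one]; exact ht)
    simpa only [ha, hx] using this
  -- hence `χ̄_p(σ) = a (mod p)`
  have hχ : ((modularCyclotomicCharacter ℂ hcp σ : (ZMod p)ˣ) : ZMod p) = (a : ZMod p) := by
    refine (modularCyclotomicCharacter.unique ℂ hcp σ (c := (a : ZMod p)) fun t ht => ?_).symm
    have htp : (t : ℂ) ^ p = 1 := by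
      have := (mem_rootsOfUnity' p t).mp ht
      exact_mod_cast this
    rw [ZMod.val_natCast, ← pow_eq_pow_mod_of_pow_eq_one htp]
    exact_mod_cast hspec (t : ℂ) htp
  set r : ℕ := ((modularCyclotomicCharacter ℂ hcp σ : (ZMod p)ˣ) : ZMod p).val with hr
  have hra : r = a % p := by rw [hr, hχ, ZMod.val_natCast]
  -- `x - a ∈ p ℤ_p`
  have hker : x - (a : ℤ_[p]) ∈ RingHom.ker (PadicInt.toZModPow 1 : ℤ_[p] →+* ZMod (p ^ 1)) := by
    rw [RingHom.mem_ker, map_sub, map_natCast, ha, ZMod.natCast_zmod_val, sub_self]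
  rw [PadicInt.ker_toZModPow, Ideal.mem_span_singleton] at hker
  obtain ⟨z, hz⟩ := hker
  -- valuations: `|p|_v < 1`, `|z|_v ≤ 1`, `|natural number|_v ≤ 1`
  have hpv : Valued.v ((p : ℕ) : v.adicCompletion K) < 1 := valued_natCast_lt_one_of_mem K v hp
  have hzv : Valued.v (algebraMap ℚ_[p] (v.adicCompletion K) (z : ℚ_[p])) ≤ 1 :=
    (HeightOneSpectrum.mem_adicCompletionIntegers (𝓞 K) K v).mp
      (algebraMap_padicInt_mem_adicCompletionIntegers K v hp z)
  have hnat : ∀ n : ℕ, Valued.v ((n : ℕ) : v.adicCompletion K) ≤ 1 := fun n ↦ by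
    have := valued_algebraMap_le_one K v ((n : ℕ) : 𝓞 K)
    simpa only [map_natCast] using this
  -- `κ₀ - a = p · z` in `K_v`
  have h1 : Valued.v (algebraMap ℚ_[p] (v.adicCompletion K) (x : ℚ_[p]) - (a : v.adicCompletion K)) < 1 := by
    have : algebraMap ℚ_[p] (v.adicCompletion K) (x : ℚ_[p]) - (a : v.adicCompletion K) =
        ((p : ℕ) : v.adicCompletion K) * algebraMap ℚ_[p] (v.adicCompletion K) (z : ℚ_[p]) := by
      rw [← map_natCast (algebraMap ℚ_[p] (v.adicCompletion K)) a, ← map_sub, ← map_natCast (algebraMap ℚ_[p] _) p,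
        ← map_mul]
      congr 1
      have := congrArg ((↑) : ℤ_[p] → ℚ_[p]) hz
      push_cast at this
      rw [pow_one] at this
      exact_mod_cast this
    rw [this, map_mul]
    calc Valued.v ((p : ℕ) : v.adicCompletion K) * Valued.v (algebraMap ℚ_[p] (v.adicCompletion K) (z : ℚ_[p]))
        ≤ Valued.v ((p : ℕ) : v.adicCompletion K) * 1 := mul_le_mul_right hzv _
      _ < 1 := by rw [mul_one]; exact hpv
  -- `a - r = p · (a / p)` in `K_v`
  have h2 : Valued.v ((a : v.adicCompletion K) - (r : v.adicCompletion K)) < 1 := by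
    have : (a : v.adicCompletion K) - (r : v.adicCompletion K) = ((p : ℕ) : v.adicCompletion K) * ((a / p : ℕ) : _) := by
      rw [hra]
      have := Nat.mod_add_div a p
      rw [sub_eq_iff_eq_add, ← Nat.cast_mul, ← Nat.cast_add, add_comm, this]
    rw [this, map_mul]
    calc Valued.v ((p : ℕ) : v.adicCompletion K) * Valued.v ((a / p : ℕ) : v.adicCompletion K)
        ≤ Valued.v ((p : ℕ) : v.adicCompletion K) * 1 := mul_le_mul_right (hnat _) _
      _ < 1 := by rw [mul_one]; exact hpv
  have hsum : algebraMap ℚ_[p] (v.adicCompletion K) (x : ℚ_[p]) - (r : v.adicCompletion K) =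
      (algebraMap ℚ_[p] (v.adicCompletion K) (x : ℚ_[p]) - (a : v.adicCompletion K)) +
        ((a : v.adicCompletion K) - (r : v.adicCompletion K)) := by ring
  rw [hsum]
  exact Valuation.map_add_lt _ h1 h2

end Local

/-! ## §2 (NT) at `𝔭 ∤ 2` in the road's currency -/

section CM

variable {L : Type} [Field L] [NumberField L] [IsCMField L]

local notation3 "L⁺" => maximalRealSubfield L

open IdeleClassGroup UnitaryGroup in
/-- **[Liu2021, Thm. 4.18 (3), the number-theoretic core at `𝔭 ∤ 2`, road currency]: the cyclotomic unit of the Galois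
twist of `ψ_𝔭` is a norm from `L_𝔭 = L ⊗_{L⁺} L⁺_𝔭`.**  Let `L` be a CM field, `μ = ψ : C_L → S¹` conjugate symplectic,
`σ` a ring automorphism of `ℂ` fixing `M_μ = fieldOfValues L ψ` pointwise, `𝔭 ∤ 2` a finite place of `L⁺`, and `κ ∈ L⁺_𝔭`
with `σ(ψ_𝔭(r)) = ψ_𝔭(κ r)` for all `r` (`ψ_𝔭 = adeleAddCharAt L⁺ 𝔭`; then `κ = χ_{cyc,p}(σ)`).  Then `κ = x · x̄` for a unit
`x` of the place model `LocalRing L 𝔭 = ∏_{w ∣ 𝔭} L_w` (so at a non-split `𝔭`: `κ ∈ Nm_{L_w/L⁺_𝔭} L_wˣ`, Liu's «`χ_p(σ) ∈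
ℤ_p^× ∩ Nm E_w^×`»). [cite: Liu2021, proof of Thm. 4.18 (3), l. 2272–2278] -/
theorem exists_mul_conjLocal_eq_of_adeleAddCharAt_galoisTwist
    {ψ : IdeleClassGroup L →ₜ* Circle} (hψ : IsConjugateSymplectic L ψ)
    (σ : ℂ ≃+* ℂ) (hσ : ∀ z ∈ fieldOfValues L ψ, σ z = z)
    (𝔭 : HeightOneSpectrum (𝓞 L⁺)) (h2 : (2 : 𝓞 L⁺) ∉ 𝔭.asIdeal)
    (κ : 𝔭.adicCompletion L⁺)
    (hκ : ∀ r : 𝔭.adicCompletion L⁺, σ (adeleAddCharAt (L⁺) 𝔭 r : ℂ) = adeleAddCharAt (L⁺) 𝔭 (κ * r)) :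
    ∃ x : (LocalRing L 𝔭)ˣ,
      (x : LocalRing L 𝔭) * conjLocal L (IsCMField.complexConj L) 𝔭 x =
        algebraMap (𝔭.adicCompletion L⁺) (LocalRing L 𝔭) κ := by
  classical
  -- the rational prime `p` below `𝔭` (odd)
  obtain ⟨p, hpr, hp⟩ := exists_rat_prime_natCast_mem 𝔭
  haveI : Fact p.Prime := ⟨hpr⟩
  haveI : NeZero p := ⟨hpr.ne_zero⟩
  have hcp : Nat.card (rootsOfUnity p ℂ) = p := HasEnoughRootsOfUnity.natCard_rootsOfUnity ℂ p
  letI := LocalField.adicCompletionPadicAlgebra 𝔭 p hp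
  -- `κ = χ_{cyc,p}(σ)` by non-degeneracy of `ψ_𝔭`
  set κ₀ : 𝔭.adicCompletion L⁺ :=
    algebraMap ℚ_[p] (𝔭.adicCompletion L⁺) (((cyclotomicCharacter ℂ p σ : ℤ_[p]ˣ) : ℤ_[p]) : ℚ_[p]) with hκ₀
  have hκeq : κ = κ₀ := by
    refine eq_of_forall_adeleAddCharAt_mul_eq 𝔭 fun r => ?_
    apply Subtype.ext
    rw [← hκ r]
    exact ringEquiv_adeleAddCharAt_eq_cyclotomicCharacter_mul (L⁺) 𝔭 hp σ r
  -- `κ ≡ χ̄_p(σ) (mod 𝔭)`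
  have hκr : Valued.v (κ - (((modularCyclotomicCharacter ℂ hcp σ : (ZMod p)ˣ) : ZMod p).val : 𝔭.adicCompletion L⁺)) < 1 := by
    rw [hκeq]
    exact valued_algebraMap_cyclotomicCharacter_sub_val_lt_one 𝔭 hp hcp σ
  -- `κ` is a `𝔭`-adic unit
  have hrcop : Nat.Coprime (((modularCyclotomicCharacter ℂ hcp σ : (ZMod p)ˣ) : ZMod p).val) p :=
    val_modularCyclotomicCharacter_coprime σ hcp
  have hκ1 : Valued.v κ = 1 :=
    valued_eq_one_of_valued_sub_natCast_lt_one 𝔭 (natCast_not_mem_of_coprime 𝔭 hp hrcop) hκr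
  have hκ0 : κ ≠ 0 := fun h0 ↦ by rw [h0, map_zero] at hκ1; exact zero_ne_one hκ1
  -- (NT) in the norm-subgroup currency
  have hmem := mem_quadraticNormSubgroup_cmQuadraticGenerator_of_fix_fieldOfValues hψ σ hσ 𝔭 h2 hp hcp
    (Units.mk0 κ hκ0) (by rw [Units.val_mk0]; exact hκr)
  -- the place model: `x x̄ = a ↔ a ∈ N(L⁺_𝔭(√θ))`, `θ = α²`
  obtain ⟨α, hα0, hαc, hαsq⟩ := cmQuadraticGenerator_spec L
  have hd : α * α = algebraMap (L⁺) L ((cmQuadraticGenerator L : 𝓞 L⁺) : L⁺) := by rw [← sq, hαsq]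
  have hiff := LemD1IndexedNonVacuityNonsplitPlace.isNorm_iff_mem_quadraticNormSubgroup L 𝔭 (IsCMField.complexConj L)
    hαc hα0 hd (Units.mk0 κ hκ0)
  rw [Units.val_mk0] at hiff
  exact hiff.mpr (by simpa only [HeightOneSpectrum.algebraMap_adicCompletion, Function.comp_apply, Algebra.algebraMap_self,
    RingHom.id_apply] using hmem)

end CM

end Literature.NumberTheory.Automorphic.Liu2021

end
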